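/-
Copyright (c) 2026 the pub-hodgecm-mathlib formalisation cell (harness21).  Prover seat hodgecm-mathlib-A-p12 (g24), 2026-09-02.  «S3-ram» (LEAD F0P3a-plan (g13); owner p06 (g15);
(Cnt2′) chair F0P3a-p07 (g14)): the W-SIDE PACK of the (α₂) TYPE-(2) line, part 3 — the ENTRY STRUCTURE of the monodromies of a 2-deep type-(2) `Γ`.  `--supports stmt-HodgeConjecture-24833`.
-/
import Literature.NumberTheory.Rogawski1990.DepthZeroKappaTransferTypeTwoRamifiedDepthBallsTop   -- ★ p847580 (this seat): `sq_sub_half_trace_smul_one`; ⊇ ★ Rescaling (`trace_and_det_of_descent`), (W1) descent, `valued_toPlace_eq_sq_of_ramified`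
import HarnessLib

/-!
# The entry structure of the monodromies `Y = u⁻¹Γu` of a 2-deep type-(2) `Γ ∈ U(σ_w, Φ₂)`: `Y − ½trΓ·1 = μ·[[ιx₀₀, ϖ·ιx₀₁], [ϖ⁻¹·ιx₁₀, −ιx₀₀]]`, and the DEPTH COLLAPSE
# (Labesse–Langlands 1979 §2; Rogawski 1990 §4.9; Serre 1980 II §1)

Topic `NumberTheory/Rogawski1990`; namespace `Literature.NumberTheory.Automorphic.UnitaryGroup`.  THEOREMS ONLY; kernel lane `--supports stmt-HodgeConjecture-24833`; cell
`pub/hodgecm-mathlib` (D-0151), crux H413, count-neutral; seat A-p12 (g24).  HONEST LABEL: HC_CM is proved only modulo the 2 remaining named inputs (hLiu418 24832, h413 24833).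

THE MATHEMATICS.  Let `Γ ∈ U = U(σ_w, Φ₂)(L_w)` be 2-DEEP (`|(Γ − 1)_{ij}|_w ≤ |ϖ²|`) with (W1) descent `D_ϖΓD_ϖ⁻¹ = s·ι(g)`; 2-deepness forces `|s·ι(g₀₀)| = |Γ₀₀| = 1`, so `μ := s·ι(g₀₀)` is a
UNIT and the descent scalar has EVEN valuation.  For any `u ∈ U` (descent `s_u·ι(g_u)`) the monodromy `Y := u⁻¹Γu = D⁻¹·s·ι(g_u⁻¹gg_u)·D` has the same scalar `s`, hence (§1)
**`E := Y − ½trΓ·1 = μ·[[ιx₀₀, ϖ·ιx₀₁], [ϖ⁻¹·ιx₁₀, −ιx₀₀]]`** with `x_{ab} ∈ L⁺_v`: the diagonal entries of `E` have EVEN valuation, the off-diagonal ones ODD valuation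
(`|ι(x)|_w = |x|_v²`).  As `E₀₀² + E₀₁E₁₀ = ¼disc`, `|disc|_w = exp(−2N)`: (§2) **DEPTH COLLAPSE** — all `|E_{ab}| ≤ |ϖ^{2j}|` and `N ≠ 2j` give `|E_{aa}| ≤ |ϖ^{2j+2}|` and
`|E_{ab}| ≤ |ϖ^{2j+1}|`.  (§3) For the (Cnt2′) W-side tokens (★ `ncard_selfDual_fixed_axis_{bd,reg,…}_eq`): on every `Γ`-fixed coset `LEV(ϖ)` is AUTOMATIC (W-side `bd` = ∅), and
for `N ≥ 2` so is `LEV₂(ϖ³)` (W-side `reg` = ∅, `{1+} ⊔ {1−} = Fix ∖ LEV(ϖ²)`, counted by ★ (B-i) balls `j = 0, 1`, split by ★ (B-ii)); odd scales are free.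

* §1 `exists_unit_entries_conj_sub_half_trace_of_twoDeep` (normal form).
* §2 `depth_collapse_of_twoDeep`.
* §3 `forall_v_conj_sub_one_le_of_twoDeep` (`LEV(ϖ)` automatic), `forall_v_conj_sub_one_sq_le_of_twoDeep` (`LEV₂(ϖ³)` automatic, `N ≥ 2`).

## References
* [LabesseLanglands1979] J.-P. Labesse, R. P. Langlands, *L-indistinguishability for SL(2)*, Canad. J. Math. 31 (1979): §2 pp. 7–8.
* [Rogawski1990] J. D. Rogawski, *Automorphic Representations of Unitary Groups in Three Variables* (1990): §4.9 pp. 54–56.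
* [Serre1980Trees] J.-P. Serre, *Trees* (1980): Ch. II §1.1–§1.3.
-/

set_option autoImplicit false

noncomputable section

open MeasureTheory Measure Set NumberField IsDedekindDomain Matrix ValuativeRel MulAction Finset Polynomial
open scoped ValuativeRel Matrix MatrixGroups WithZero

namespace Literature.NumberTheory.Automorphic.UnitaryGroup

open Literature.NumberTheory.Rogawski1990 Literature.NumberTheory.Automorphic Literature.NumberTheory.Automorphic.IntegralReduction
open Literature.NumberTheory.Automorphic.HermitianLatticeTree Literature.GroupTheory Literature.NumberTheory.GaloisRepresentations

section Structure
variable (L : Type) [Field L] [NumberField L] [IsCMField L] (v : HeightOneSpectrum (𝓞 ↥(maximalRealSubfield L)))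
  (w : PlacesOver L v) (hw : IsCMField.complexConj L • w.1 = w.1)

/-! ## §1 The normal form of the entries of `u⁻¹Γu − ½trΓ·1` -/
set_option maxHeartbeats 800000 in
include hw in
/-- **NORMAL FORM OF THE MONODROMY ENTRIES.**  For a 2-deep `Γ ∈ U(σ_w, Φ₂)` and any `u ∈ U(σ_w, Φ₂)` there are a unit `μ ∈ L_w` and `x₀₀, x₀₁, x₁₀ ∈ L⁺_v` with
`E := u⁻¹Γu − ½trΓ·1 = [[μ·ιx₀₀, μ·ϖ·ιx₀₁], [μ·ϖ⁻¹·ιx₁₀, −μ·ιx₀₀]]` — the (W1) descents of `Γ` and `u` share the scalar `s`, `μ = s·ι(g₀₀)` is a unit by 2-deepness, and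
`x_{ab} = (g_u⁻¹gg_u − ½t)_{ab} ∕ g₀₀`. [cite: LabesseLanglands1979, §2 p. 7] [cite: Rogawski1990, §4.9 p. 55] -/
theorem exists_unit_entries_conj_sub_half_trace_of_twoDeep (ϖ : (w.1.adicCompletion L)ˣ) (hϖ : Valued.v (ϖ : (w.1.adicCompletion L)) = WithZero.exp (-1 : ℤ))
    (hσϖ : galAdicCompletionMap (L := L) (IsCMField.complexConj L) hw (ϖ : (w.1.adicCompletion L)) = -(ϖ : (w.1.adicCompletion L)))
    (Γ u : GL (Fin 2) (w.1.adicCompletion L))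
    (hΓ : Γ ∈ unitaryGroupOfForm (galAdicCompletionMap (L := L) (IsCMField.complexConj L) hw) (placeForm (Matrix.of fun i j : Fin 2 => if i.val + j.val + 1 = 2 then (1 : L) else 0) w.1))
    (hu : u ∈ unitaryGroupOfForm (galAdicCompletionMap (L := L) (IsCMField.complexConj L) hw) (placeForm (Matrix.of fun i j : Fin 2 => if i.val + j.val + 1 = 2 then (1 : L) else 0) w.1))
    (h2deep : ∀ i j : Fin 2, Valued.v (((Γ : Matrix (Fin 2) (Fin 2) (w.1.adicCompletion L)) - 1) i j) ≤ Valued.v ((ϖ : (w.1.adicCompletion L)) ^ 2)) :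
    ∃ (μ : (w.1.adicCompletion L)) (x₀₀ x₀₁ x₁₀ : (v.adicCompletion ↥(maximalRealSubfield L))), Valued.v μ = 1 ∧
      (((u⁻¹ * Γ * u : GL (Fin 2) (w.1.adicCompletion L)) : Matrix (Fin 2) (Fin 2) (w.1.adicCompletion L)) - ((Γ : Matrix (Fin 2) (Fin 2) (w.1.adicCompletion L)).trace / 2) • (1 : Matrix (Fin 2) (Fin 2) (w.1.adicCompletion L))) 0 0 = μ * toPlace v w x₀₀ ∧
      (((u⁻¹ * Γ * u : GL (Fin 2) (w.1.adicCompletion L)) : Matrix (Fin 2) (Fin 2) (w.1.adicCompletion L)) - ((Γ : Matrix (Fin 2) (Fin 2) (w.1.adicCompletion L)).trace / 2) • (1 : Matrix (Fin 2) (Fin 2) (w.1.adicCompletion L))) 1 1 = -(μ * toPlace v w x₀₀) ∧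
      (((u⁻¹ * Γ * u : GL (Fin 2) (w.1.adicCompletion L)) : Matrix (Fin 2) (Fin 2) (w.1.adicCompletion L)) - ((Γ : Matrix (Fin 2) (Fin 2) (w.1.adicCompletion L)).trace / 2) • (1 : Matrix (Fin 2) (Fin 2) (w.1.adicCompletion L))) 0 1 = μ * (ϖ : (w.1.adicCompletion L)) * toPlace v w x₀₁ ∧
      (((u⁻¹ * Γ * u : GL (Fin 2) (w.1.adicCompletion L)) : Matrix (Fin 2) (Fin 2) (w.1.adicCompletion L)) - ((Γ : Matrix (Fin 2) (Fin 2) (w.1.adicCompletion L)).trace / 2) • (1 : Matrix (Fin 2) (Fin 2) (w.1.adicCompletion L))) 1 0 = μ * (ϖ : (w.1.adicCompletion L))⁻¹ * toPlace v w x₁₀ := by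
  have hϖ0 : (ϖ : (w.1.adicCompletion L)) ≠ 0 := ϖ.ne_zero
  have hϖ1 : Valued.v (ϖ : (w.1.adicCompletion L)) < 1 := by rw [hϖ, ← WithZero.exp_zero]; exact WithZero.exp_lt_exp.2 (by norm_num)
  rw [unitaryGroupOfForm_placeForm_antidiagTwo_eq] at hΓ hu
  obtain ⟨s, g, hs, hsg⟩ := descent_of_mem_unitaryGroupOfForm_antidiag L v w hw hσϖ hϖ0 _ hΓ
  obtain ⟨s', g', hs', hsg'⟩ := descent_of_mem_unitaryGroupOfForm_antidiag L v w hw hσϖ hϖ0 _ hu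
  have hD := diagonal_inv_mul_diagonal (E := (w.1.adicCompletion L)) hϖ0
  have hD' := diagonal_mul_diagonal_inv (E := (w.1.adicCompletion L)) hϖ0
  have conjback : ∀ X : Matrix (Fin 2) (Fin 2) (w.1.adicCompletion L), X = Matrix.diagonal ![1, (ϖ : (w.1.adicCompletion L))⁻¹] * (Matrix.diagonal ![1, (ϖ : (w.1.adicCompletion L))] * X * Matrix.diagonal ![1, (ϖ : (w.1.adicCompletion L))⁻¹]) * Matrix.diagonal ![1, (ϖ : (w.1.adicCompletion L))] := by
    intro X
    calc X = (Matrix.diagonal ![1, (ϖ : (w.1.adicCompletion L))⁻¹] * Matrix.diagonal ![1, (ϖ : (w.1.adicCompletion L))]) * X * (Matrix.diagonal ![1, (ϖ : (w.1.adicCompletion L))⁻¹] * Matrix.diagonal ![1, (ϖ : (w.1.adicCompletion L))]) := by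
          rw [hD, Matrix.one_mul, Matrix.mul_one]
      _ = _ := by simp only [Matrix.mul_assoc]
  have hΓv : (Γ : Matrix (Fin 2) (Fin 2) (w.1.adicCompletion L)) = Matrix.diagonal ![1, (ϖ : (w.1.adicCompletion L))⁻¹] * (s • (g : Matrix (Fin 2) (Fin 2) (v.adicCompletion ↥(maximalRealSubfield L))).map (toPlace v w)) * Matrix.diagonal ![1, (ϖ : (w.1.adicCompletion L))] := by
    rw [← hsg]; exact conjback _
  have huv : (u : Matrix (Fin 2) (Fin 2) (w.1.adicCompletion L)) = Matrix.diagonal ![1, (ϖ : (w.1.adicCompletion L))⁻¹] * (s' • (g' : Matrix (Fin 2) (Fin 2) (v.adicCompletion ↥(maximalRealSubfield L))).map (toPlace v w)) * Matrix.diagonal ![1, (ϖ : (w.1.adicCompletion L))] := by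
    rw [← hsg']; exact conjback _
  have hg'g : ((g'⁻¹ : GL (Fin 2) (v.adicCompletion ↥(maximalRealSubfield L))) : Matrix (Fin 2) (Fin 2) (v.adicCompletion ↥(maximalRealSubfield L))).map (toPlace v w) *
      (g' : Matrix (Fin 2) (Fin 2) (v.adicCompletion ↥(maximalRealSubfield L))).map (toPlace v w) = 1 := by
    rw [← Matrix.map_mul, ← Units.val_mul, inv_mul_cancel, Units.val_one, Matrix.map_one _ (map_zero _) (map_one _)]
  have hcancel : ∀ X : Matrix (Fin 2) (Fin 2) (w.1.adicCompletion L), Matrix.diagonal ![1, (ϖ : (w.1.adicCompletion L))] * (Matrix.diagonal ![1, (ϖ : (w.1.adicCompletion L))⁻¹] * X) = X :=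
    fun X => by rw [← Matrix.mul_assoc, hD', Matrix.one_mul]
  have huinv : ((u⁻¹ : GL (Fin 2) (w.1.adicCompletion L)) : Matrix (Fin 2) (Fin 2) (w.1.adicCompletion L)) =
      Matrix.diagonal ![1, (ϖ : (w.1.adicCompletion L))⁻¹] * (s'⁻¹ • ((g'⁻¹ : GL (Fin 2) (v.adicCompletion ↥(maximalRealSubfield L))) : Matrix (Fin 2) (Fin 2) (v.adicCompletion ↥(maximalRealSubfield L))).map (toPlace v w)) * Matrix.diagonal ![1, (ϖ : (w.1.adicCompletion L))] := by
    rw [Matrix.coe_units_inv]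
    refine Matrix.inv_eq_left_inv ?_
    rw [huv]
    simp only [Matrix.smul_mul, Matrix.mul_smul, smul_smul, Matrix.mul_assoc, hcancel]
    rw [← Matrix.mul_assoc (((g'⁻¹ : GL (Fin 2) (v.adicCompletion ↥(maximalRealSubfield L))) : Matrix (Fin 2) (Fin 2) (v.adicCompletion ↥(maximalRealSubfield L))).map (toPlace v w)), hg'g, Matrix.one_mul, hD,
      mul_inv_cancel₀ hs', one_smul]
  have hconj : ((u⁻¹ * Γ * u : GL (Fin 2) (w.1.adicCompletion L)) : Matrix (Fin 2) (Fin 2) (w.1.adicCompletion L)) =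
      Matrix.diagonal ![1, (ϖ : (w.1.adicCompletion L))⁻¹] * (s • (((g'⁻¹ * g * g' : GL (Fin 2) (v.adicCompletion ↥(maximalRealSubfield L))) : Matrix (Fin 2) (Fin 2) (v.adicCompletion ↥(maximalRealSubfield L))).map (toPlace v w))) * Matrix.diagonal ![1, (ϖ : (w.1.adicCompletion L))] := by
    rw [Units.val_mul, Units.val_mul, huinv, hΓv, huv, Units.val_mul, Units.val_mul, Matrix.map_mul, Matrix.map_mul]
    simp only [Matrix.smul_mul, Matrix.mul_smul, smul_smul, Matrix.mul_assoc, hcancel]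
    rw [show s' * (s * s'⁻¹) = s by field_simp]
  have hΓ00 : (Γ : Matrix (Fin 2) (Fin 2) (w.1.adicCompletion L)) 0 0 = s * toPlace v w ((g : Matrix (Fin 2) (Fin 2) (v.adicCompletion ↥(maximalRealSubfield L))) 0 0) := by
    rw [hΓv]; simp [Matrix.mul_apply, Matrix.diagonal, Matrix.map_apply]
  have hμ : Valued.v (s * toPlace v w ((g : Matrix (Fin 2) (Fin 2) (v.adicCompletion ↥(maximalRealSubfield L))) 0 0)) = 1 := by
    rw [← hΓ00]
    have h := h2deep 0 0
    rw [Matrix.sub_apply, Matrix.one_apply_eq] at h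
    have hlt : Valued.v ((Γ : Matrix (Fin 2) (Fin 2) (w.1.adicCompletion L)) 0 0 - 1) < 1 := lt_of_le_of_lt h (by rw [map_pow]; exact pow_lt_one₀ zero_le hϖ1 two_ne_zero)
    have e : (Γ : Matrix (Fin 2) (Fin 2) (w.1.adicCompletion L)) 0 0 = 1 + ((Γ : Matrix (Fin 2) (Fin 2) (w.1.adicCompletion L)) 0 0 - 1) := by ring
    rw [e]; exact Valuation.map_one_add_of_lt _ hlt
  have hg00 : (g : Matrix (Fin 2) (Fin 2) (v.adicCompletion ↥(maximalRealSubfield L))) 0 0 ≠ 0 := by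
    intro h0; rw [h0, map_zero, mul_zero, map_zero] at hμ; exact zero_ne_one hμ
  obtain ⟨htrΓ, -⟩ := trace_and_det_of_descent (toPlace v w) hϖ0 hsg
  have htr' : ((g'⁻¹ * g * g' : GL (Fin 2) (v.adicCompletion ↥(maximalRealSubfield L))) : Matrix (Fin 2) (Fin 2) (v.adicCompletion ↥(maximalRealSubfield L))).trace = (g : Matrix (Fin 2) (Fin 2) (v.adicCompletion ↥(maximalRealSubfield L))).trace := by
    rw [Units.val_mul, Units.val_mul]; exact Matrix.trace_units_conj' g' _
  set G : Matrix (Fin 2) (Fin 2) (v.adicCompletion ↥(maximalRealSubfield L)) := ((g'⁻¹ * g * g' : GL (Fin 2) (v.adicCompletion ↥(maximalRealSubfield L))) : Matrix (Fin 2) (Fin 2) (v.adicCompletion ↥(maximalRealSubfield L))) with hGdef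
  have hG11 : G 1 1 = (g : Matrix (Fin 2) (Fin 2) (v.adicCompletion ↥(maximalRealSubfield L))).trace - G 0 0 := by
    rw [← htr', Matrix.trace_fin_two]; ring
  have hE : ∀ a b : Fin 2, (((u⁻¹ * Γ * u : GL (Fin 2) (w.1.adicCompletion L)) : Matrix (Fin 2) (Fin 2) (w.1.adicCompletion L)) - ((Γ : Matrix (Fin 2) (Fin 2) (w.1.adicCompletion L)).trace / 2) • (1 : Matrix (Fin 2) (Fin 2) (w.1.adicCompletion L))) a b =
      (Matrix.diagonal ![1, (ϖ : (w.1.adicCompletion L))⁻¹] * (s • G.map (toPlace v w)) * Matrix.diagonal ![1, (ϖ : (w.1.adicCompletion L))]) a b - (s * toPlace v w ((g : Matrix (Fin 2) (Fin 2) (v.adicCompletion ↥(maximalRealSubfield L))).trace / 2)) * (1 : Matrix (Fin 2) (Fin 2) (w.1.adicCompletion L)) a b := by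
    intro a b
    rw [Matrix.sub_apply, hconj, Matrix.smul_apply, smul_eq_mul, htrΓ, map_div₀, map_ofNat, mul_div_assoc]
  refine ⟨s * toPlace v w ((g : Matrix (Fin 2) (Fin 2) (v.adicCompletion ↥(maximalRealSubfield L))) 0 0),
    (G 0 0 - (g : Matrix (Fin 2) (Fin 2) (v.adicCompletion ↥(maximalRealSubfield L))).trace / 2) / (g : Matrix (Fin 2) (Fin 2) (v.adicCompletion ↥(maximalRealSubfield L))) 0 0,
    G 0 1 / (g : Matrix (Fin 2) (Fin 2) (v.adicCompletion ↥(maximalRealSubfield L))) 0 0,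
    G 1 0 / (g : Matrix (Fin 2) (Fin 2) (v.adicCompletion ↥(maximalRealSubfield L))) 0 0, hμ, ?_, ?_, ?_, ?_⟩
  all_goals have hιg00 : toPlace v w ((g : Matrix (Fin 2) (Fin 2) (v.adicCompletion ↥(maximalRealSubfield L))) 0 0) ≠ 0 := by rw [_root_.map_ne_zero]; exact hg00
  all_goals rw [hE]
  all_goals simp only [Matrix.mul_apply, Fin.sum_univ_two, Matrix.diagonal, Matrix.of_apply, Matrix.smul_apply, Matrix.map_apply, smul_eq_mul, Matrix.one_apply,
      Matrix.cons_val_zero, Matrix.cons_val_one, map_div₀, map_sub, map_ofNat]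
  all_goals simp
  · field_simp
  · rw [hG11, map_sub]; field_simp; ring
  · field_simp
  · field_simp

/-! ## §2 The depth collapse -/
omit [IsCMField L] in
/-- Integer exponents: `|x|_v = exp(m)` for `x ≠ 0`. [cite: Serre1979, Ch. II §2] -/
theorem exists_v_eq_exp (x : (v.adicCompletion ↥(maximalRealSubfield L))) (hx : x ≠ 0) : ∃ m : ℤ, Valued.v x = WithZero.exp m :=
  ⟨_, (WithZero.exp_log ((Valuation.ne_zero_iff _).2 hx)).symm⟩
set_option maxHeartbeats 800000 in
include hw in
/-- **DEPTH COLLAPSE.**  For a 2-deep `Γ ∈ U(σ_w, Φ₂)` of discriminant depth `|tr²Γ − 4detΓ|_w = exp(−2N)` and any `u ∈ U`, put `E := u⁻¹Γu − ½trΓ·1`.  If all `|E_{ab}|_w ≤ |ϖ^{2j}|`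
and `N ≠ 2j`, then `|E₀₀|, |E₁₁| ≤ |ϖ^{2j+2}|` and all `|E_{ab}| ≤ |ϖ^{2j+1}|` (§1 normal form: diagonal valuations are even, off-diagonal odd; `E₀₀² + E₀₁E₁₀ = ¼disc` by ★
`sq_sub_half_trace_smul_one`, so `|E₀₀| = |ϖ^{2j}|` would force `N = 2j`). [cite: LabesseLanglands1979, §2 Lemma 2.1 p. 8] [cite: Serre1980Trees, Ch. II §1.1] -/
theorem depth_collapse_of_twoDeep (he : v.asIdeal.ramificationIdx' w.1.asIdeal ≠ 1) (h2 : IsUnit (2 : 𝒪[(w.1.adicCompletion L)]))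
    (ϖ : (w.1.adicCompletion L)ˣ) (hϖ : Valued.v (ϖ : (w.1.adicCompletion L)) = WithZero.exp (-1 : ℤ))
    (hσϖ : galAdicCompletionMap (L := L) (IsCMField.complexConj L) hw (ϖ : (w.1.adicCompletion L)) = -(ϖ : (w.1.adicCompletion L)))
    (Γ u : GL (Fin 2) (w.1.adicCompletion L))
    (hΓ : Γ ∈ unitaryGroupOfForm (galAdicCompletionMap (L := L) (IsCMField.complexConj L) hw) (placeForm (Matrix.of fun i j : Fin 2 => if i.val + j.val + 1 = 2 then (1 : L) else 0) w.1))
    (hu : u ∈ unitaryGroupOfForm (galAdicCompletionMap (L := L) (IsCMField.complexConj L) hw) (placeForm (Matrix.of fun i j : Fin 2 => if i.val + j.val + 1 = 2 then (1 : L) else 0) w.1))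
    (h2deep : ∀ i j : Fin 2, Valued.v (((Γ : Matrix (Fin 2) (Fin 2) (w.1.adicCompletion L)) - 1) i j) ≤ Valued.v ((ϖ : (w.1.adicCompletion L)) ^ 2))
    {N : ℕ} (hN : Valued.v ((Γ : Matrix (Fin 2) (Fin 2) (w.1.adicCompletion L)).trace ^ 2 - 4 * (Γ : Matrix (Fin 2) (Fin 2) (w.1.adicCompletion L)).det) = WithZero.exp (-((2 * N : ℕ) : ℤ)))
    {j : ℕ} (hNj : N ≠ 2 * j)
    (hE : ∀ a b : Fin 2, Valued.v ((((u⁻¹ * Γ * u : GL (Fin 2) (w.1.adicCompletion L)) : Matrix (Fin 2) (Fin 2) (w.1.adicCompletion L)) - ((Γ : Matrix (Fin 2) (Fin 2) (w.1.adicCompletion L)).trace / 2) • (1 : Matrix (Fin 2) (Fin 2) (w.1.adicCompletion L))) a b) ≤ Valued.v ((ϖ : (w.1.adicCompletion L)) ^ (2 * j))) :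
    (∀ a : Fin 2, Valued.v ((((u⁻¹ * Γ * u : GL (Fin 2) (w.1.adicCompletion L)) : Matrix (Fin 2) (Fin 2) (w.1.adicCompletion L)) - ((Γ : Matrix (Fin 2) (Fin 2) (w.1.adicCompletion L)).trace / 2) • (1 : Matrix (Fin 2) (Fin 2) (w.1.adicCompletion L))) a a) ≤ Valued.v ((ϖ : (w.1.adicCompletion L)) ^ (2 * j + 2))) ∧
    ∀ a b : Fin 2, Valued.v ((((u⁻¹ * Γ * u : GL (Fin 2) (w.1.adicCompletion L)) : Matrix (Fin 2) (Fin 2) (w.1.adicCompletion L)) - ((Γ : Matrix (Fin 2) (Fin 2) (w.1.adicCompletion L)).trace / 2) • (1 : Matrix (Fin 2) (Fin 2) (w.1.adicCompletion L))) a b) ≤ Valued.v ((ϖ : (w.1.adicCompletion L)) ^ (2 * j + 1)) := by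
  have hϖ0 : (ϖ : (w.1.adicCompletion L)) ≠ 0 := ϖ.ne_zero
  have h2w : Valued.v (2 : (w.1.adicCompletion L)) = 1 := (isUnit_two_integer_iff_valued_eq_one L w.1).1 h2
  have h2w0 : (2 : (w.1.adicCompletion L)) ≠ 0 := fun h0 => by rw [h0, map_zero] at h2w; exact zero_ne_one h2w
  obtain ⟨μ, x₀₀, x₀₁, x₁₀, hμ, h00, h11, h01, h10⟩ := exists_unit_entries_conj_sub_half_trace_of_twoDeep L v w hw ϖ hϖ hσϖ Γ u hΓ hu h2deep
  have hsq : ∀ y : (v.adicCompletion ↥(maximalRealSubfield L)), Valued.v (toPlace v w y) = Valued.v y ^ 2 := valued_toPlace_eq_sq_of_ramified L v w hw he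
  have hv00 : Valued.v ((((u⁻¹ * Γ * u : GL (Fin 2) (w.1.adicCompletion L)) : Matrix (Fin 2) (Fin 2) (w.1.adicCompletion L)) - ((Γ : Matrix (Fin 2) (Fin 2) (w.1.adicCompletion L)).trace / 2) • (1 : Matrix (Fin 2) (Fin 2) (w.1.adicCompletion L))) 0 0) = Valued.v x₀₀ ^ 2 := by
    rw [h00, map_mul, hμ, one_mul, hsq]
  have hv11 : Valued.v ((((u⁻¹ * Γ * u : GL (Fin 2) (w.1.adicCompletion L)) : Matrix (Fin 2) (Fin 2) (w.1.adicCompletion L)) - ((Γ : Matrix (Fin 2) (Fin 2) (w.1.adicCompletion L)).trace / 2) • (1 : Matrix (Fin 2) (Fin 2) (w.1.adicCompletion L))) 1 1) = Valued.v x₀₀ ^ 2 := by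
    rw [h11, Valuation.map_neg, map_mul, hμ, one_mul, hsq]
  have hv01 : Valued.v ((((u⁻¹ * Γ * u : GL (Fin 2) (w.1.adicCompletion L)) : Matrix (Fin 2) (Fin 2) (w.1.adicCompletion L)) - ((Γ : Matrix (Fin 2) (Fin 2) (w.1.adicCompletion L)).trace / 2) • (1 : Matrix (Fin 2) (Fin 2) (w.1.adicCompletion L))) 0 1) = WithZero.exp (-1 : ℤ) * Valued.v x₀₁ ^ 2 := by
    rw [h01, map_mul, map_mul, hμ, one_mul, hϖ, hsq]
  have hv10 : Valued.v ((((u⁻¹ * Γ * u : GL (Fin 2) (w.1.adicCompletion L)) : Matrix (Fin 2) (Fin 2) (w.1.adicCompletion L)) - ((Γ : Matrix (Fin 2) (Fin 2) (w.1.adicCompletion L)).trace / 2) • (1 : Matrix (Fin 2) (Fin 2) (w.1.adicCompletion L))) 1 0) = WithZero.exp (1 : ℤ) * Valued.v x₁₀ ^ 2 := by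
    rw [h10, map_mul, map_mul, hμ, one_mul, map_inv₀, hϖ, ← WithZero.exp_neg, neg_neg, hsq]
  have hϖpow : ∀ k : ℕ, Valued.v ((ϖ : (w.1.adicCompletion L)) ^ k) = WithZero.exp (-(k : ℤ)) := by
    intro k; rw [map_pow, hϖ, ← WithZero.exp_nsmul]; simp
  have hint : ∀ (y : (v.adicCompletion ↥(maximalRealSubfield L))) (e : ℤ) (k m : ℤ), WithZero.exp e * Valued.v y ^ 2 ≤ WithZero.exp (-k) → k + e ≤ 2 * m → (∀ n : ℤ, 2 * n ≤ -k - e → n ≤ -m) →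
      Valued.v y ≤ WithZero.exp (-m) := by
    intro y e k m h hkm hround
    rcases eq_or_ne y 0 with hy0 | hy0
    · rw [hy0, map_zero]; exact zero_le
    obtain ⟨n, hn⟩ := exists_v_eq_exp L v y hy0
    rw [hn, ← WithZero.exp_nsmul, ← WithZero.exp_add, WithZero.exp_le_exp] at h
    rw [hn, WithZero.exp_le_exp]
    have h' : 2 * n ≤ -k - e := by simp only [nsmul_eq_mul, Nat.cast_ofNat] at h; omega
    exact hround n h'
  have hE00 := hE 0 0; have hE01 := hE 0 1; have hE10 := hE 1 0
  rw [hv00] at hE00; rw [hv01] at hE01; rw [hv10] at hE10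
  rw [hϖpow] at hE00 hE01 hE10
  have hx01 : Valued.v x₀₁ ≤ WithZero.exp (-(j : ℤ)) :=
    hint x₀₁ (-1) (2 * j : ℕ) j hE01 (by push_cast; omega) (fun n hn => by push_cast at hn; omega)
  have hx10 : Valued.v x₁₀ ≤ WithZero.exp (-((j : ℤ) + 1)) :=
    hint x₁₀ 1 (2 * j : ℕ) (j + 1) hE10 (by push_cast; omega) (fun n hn => by push_cast at hn; omega)
  have hx00' : Valued.v x₀₀ ≤ WithZero.exp (-(j : ℤ)) :=
    hint x₀₀ 0 (2 * j : ℕ) j (by simpa only [WithZero.exp_zero, one_mul] using hE00) (by push_cast; omega) (fun n hn => by push_cast at hn; omega)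
  have hx00 : Valued.v x₀₀ ≤ WithZero.exp (-((j : ℤ) + 1)) := by
    by_contra hlt
    rw [not_le] at hlt
    -- then `|x₀₀| = exp(−j)`
    have hx0 : x₀₀ ≠ 0 := fun h0 => by rw [h0, map_zero] at hlt; exact not_lt.2 zero_le hlt
    obtain ⟨m, hm⟩ := exists_v_eq_exp L v x₀₀ hx0
    have hmj : m = -(j : ℤ) := by
      rw [hm, WithZero.exp_le_exp] at hx00'; rw [hm, WithZero.exp_lt_exp] at hlt; omega
    -- `E₀₀² + E₀₁E₁₀ = ¼ disc`: the `(0,0)` entry of ★ `sq_sub_half_trace_smul_one`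
    have hCH := sq_sub_half_trace_smul_one h2w0 (((u⁻¹ * Γ * u : GL (Fin 2) (w.1.adicCompletion L)) : Matrix (Fin 2) (Fin 2) (w.1.adicCompletion L)))
    have htrc : (((u⁻¹ * Γ * u : GL (Fin 2) (w.1.adicCompletion L)) : Matrix (Fin 2) (Fin 2) (w.1.adicCompletion L))).trace = (Γ : Matrix (Fin 2) (Fin 2) (w.1.adicCompletion L)).trace := by
      rw [Units.val_mul, Units.val_mul]; exact Matrix.trace_units_conj' u _
    have hdetc : (((u⁻¹ * Γ * u : GL (Fin 2) (w.1.adicCompletion L)) : Matrix (Fin 2) (Fin 2) (w.1.adicCompletion L))).det = (Γ : Matrix (Fin 2) (Fin 2) (w.1.adicCompletion L)).det := by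
      rw [Units.val_mul, Units.val_mul]; exact Matrix.det_units_conj' u _
    rw [htrc, hdetc] at hCH
    have h00e := congrArg (fun M : Matrix (Fin 2) (Fin 2) (w.1.adicCompletion L) => M 0 0) hCH
    simp only [Matrix.mul_apply, Fin.sum_univ_two, Matrix.smul_apply, Matrix.one_apply_eq, smul_eq_mul, mul_one] at h00e
    rw [h00, h01, h10] at h00e
    -- `μ² ι(x₀₀² + x₀₁x₁₀) = ¼ disc`
    have hval : Valued.v (x₀₀ ^ 2 + x₀₁ * x₁₀) ^ 2 = WithZero.exp (-((2 * N : ℕ) : ℤ)) := by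
      have e : μ * toPlace v w x₀₀ * (μ * toPlace v w x₀₀) + μ * (ϖ : (w.1.adicCompletion L)) * toPlace v w x₀₁ * (μ * (ϖ : (w.1.adicCompletion L))⁻¹ * toPlace v w x₁₀) =
          μ ^ 2 * toPlace v w (x₀₀ ^ 2 + x₀₁ * x₁₀) := by
        rw [map_add, map_pow, map_mul]; field_simp
      rw [e] at h00e
      have h4 : ((Γ : Matrix (Fin 2) (Fin 2) (w.1.adicCompletion L)).trace / 2) ^ 2 - (Γ : Matrix (Fin 2) (Fin 2) (w.1.adicCompletion L)).det =
          ((Γ : Matrix (Fin 2) (Fin 2) (w.1.adicCompletion L)).trace ^ 2 - 4 * (Γ : Matrix (Fin 2) (Fin 2) (w.1.adicCompletion L)).det) / 4 := by field_simp; ring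
      have hv4 : Valued.v (4 : (w.1.adicCompletion L)) = 1 := by rw [show (4 : (w.1.adicCompletion L)) = 2 * 2 by norm_num, map_mul, h2w, one_mul]
      have := congrArg Valued.v h00e
      rw [map_mul, map_pow, hμ, one_pow, one_mul, hsq, h4, map_div₀, hv4, div_one, hN] at this
      exact this
    -- but `|x₀₀²| = exp(−2j) > |x₀₁x₁₀|`, so `|x₀₀² + x₀₁x₁₀| = exp(−2j)`
    have hdom : Valued.v (x₀₁ * x₁₀) < Valued.v (x₀₀ ^ 2) := by
      rw [map_mul, map_pow, hm, hmj, ← WithZero.exp_nsmul]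
      calc Valued.v x₀₁ * Valued.v x₁₀ ≤ WithZero.exp (-(j : ℤ)) * WithZero.exp (-((j : ℤ) + 1)) := mul_le_mul' hx01 hx10
        _ < WithZero.exp (2 • (-(j : ℤ))) := by rw [← WithZero.exp_add, WithZero.exp_lt_exp]; simp only [nsmul_eq_mul, Nat.cast_ofNat]; omega
    have hsum : Valued.v (x₀₀ ^ 2 + x₀₁ * x₁₀) = WithZero.exp (2 • (-(j : ℤ))) := by
      rw [Valuation.map_add_eq_of_lt_left _ hdom, map_pow, hm, hmj, ← WithZero.exp_nsmul]
    rw [hsum, ← WithZero.exp_nsmul, WithZero.exp_inj] at hval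
    simp only [nsmul_eq_mul, Nat.cast_mul, Nat.cast_ofNat] at hval
    omega
  -- conclude
  have hd : Valued.v x₀₀ ^ 2 ≤ Valued.v ((ϖ : (w.1.adicCompletion L)) ^ (2 * j + 2)) := by
    refine le_trans (pow_le_pow_left₀ zero_le hx00 2) ?_
    rw [hϖpow, ← WithZero.exp_nsmul, WithZero.exp_le_exp]; simp only [nsmul_eq_mul, Nat.cast_ofNat]; push_cast; omega
  have hodd : Valued.v ((ϖ : (w.1.adicCompletion L)) ^ (2 * j + 1)) = WithZero.exp (-((2 * j + 1 : ℕ) : ℤ)) := hϖpow _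
  have hd' : Valued.v x₀₀ ^ 2 ≤ Valued.v ((ϖ : (w.1.adicCompletion L)) ^ (2 * j + 1)) := by
    refine le_trans (pow_le_pow_left₀ zero_le hx00 2) ?_
    rw [hodd, ← WithZero.exp_nsmul, WithZero.exp_le_exp]; simp only [nsmul_eq_mul, Nat.cast_ofNat]; push_cast; omega
  have h01' : WithZero.exp (-1 : ℤ) * Valued.v x₀₁ ^ 2 ≤ Valued.v ((ϖ : (w.1.adicCompletion L)) ^ (2 * j + 1)) := by
    rw [hodd]
    calc WithZero.exp (-1 : ℤ) * Valued.v x₀₁ ^ 2 ≤ WithZero.exp (-1 : ℤ) * WithZero.exp (-(j : ℤ)) ^ 2 := mul_le_mul_right (pow_le_pow_left₀ zero_le hx01 2) _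
      _ = WithZero.exp (-((2 * j + 1 : ℕ) : ℤ)) := by
          rw [← WithZero.exp_nsmul, ← WithZero.exp_add, WithZero.exp_inj]; simp only [nsmul_eq_mul, Nat.cast_ofNat]; push_cast; ring
  have h10' : WithZero.exp (1 : ℤ) * Valued.v x₁₀ ^ 2 ≤ Valued.v ((ϖ : (w.1.adicCompletion L)) ^ (2 * j + 1)) := by
    rw [hodd]
    calc WithZero.exp (1 : ℤ) * Valued.v x₁₀ ^ 2 ≤ WithZero.exp (1 : ℤ) * WithZero.exp (-((j : ℤ) + 1)) ^ 2 := mul_le_mul_right (pow_le_pow_left₀ zero_le hx10 2) _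
      _ = WithZero.exp (-((2 * j + 1 : ℕ) : ℤ)) := by
          rw [← WithZero.exp_nsmul, ← WithZero.exp_add, WithZero.exp_inj]; simp only [nsmul_eq_mul, Nat.cast_ofNat]; push_cast; ring
  refine ⟨fun a => ?_, fun a b => ?_⟩
  · fin_cases a
    · simp only [Fin.zero_eta, Fin.isValue]; rw [hv00]; exact hd
    · simp only [Fin.mk_one, Fin.isValue]; rw [hv11]; exact hd
  · fin_cases a <;> fin_cases b
    · simp only [Fin.zero_eta, Fin.isValue]; rw [hv00]; exact hd'
    · simp only [Fin.zero_eta, Fin.mk_one, Fin.isValue]; rw [hv01]; exact h01'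
    · simp only [Fin.zero_eta, Fin.mk_one, Fin.isValue]; rw [hv10]; exact h10'
    · simp only [Fin.mk_one, Fin.isValue]; rw [hv11]; exact hd'


/-! ## §3 Corollaries: `LEV(ϖ)` and `LEV₂(ϖ³)` are automatic on the fixed cosets -/
set_option maxHeartbeats 800000 in
include hw in
/-- **`LEV(ϖ)` IS AUTOMATIC** (the W-side `bd` family is empty): for a 2-deep type-(2) `Γ` of discriminant depth `N ≥ 1` and any `u ∈ U` with `Y := u⁻¹Γu ∈ GL₂(𝒪_w)` (a `Γ`-fixed
coset), `|(Y − 1)_{ab}|_w ≤ |ϖ|` for all `a, b` (§2 at `j = 0`, and `|½trΓ − 1| ≤ |ϖ²|`). [cite: LabesseLanglands1979, §2 Lemma 2.1 p. 8] [cite: Rogawski1990, §4.9 p. 55] -/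
theorem forall_v_conj_sub_one_le_of_twoDeep (he : v.asIdeal.ramificationIdx' w.1.asIdeal ≠ 1) (h2 : IsUnit (2 : 𝒪[(w.1.adicCompletion L)]))
    (ϖ : (w.1.adicCompletion L)ˣ) (hϖ : Valued.v (ϖ : (w.1.adicCompletion L)) = WithZero.exp (-1 : ℤ))
    (hσϖ : galAdicCompletionMap (L := L) (IsCMField.complexConj L) hw (ϖ : (w.1.adicCompletion L)) = -(ϖ : (w.1.adicCompletion L)))
    (Γ u : GL (Fin 2) (w.1.adicCompletion L))
    (hΓ : Γ ∈ unitaryGroupOfForm (galAdicCompletionMap (L := L) (IsCMField.complexConj L) hw) (placeForm (Matrix.of fun i j : Fin 2 => if i.val + j.val + 1 = 2 then (1 : L) else 0) w.1))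
    (hu : u ∈ unitaryGroupOfForm (galAdicCompletionMap (L := L) (IsCMField.complexConj L) hw) (placeForm (Matrix.of fun i j : Fin 2 => if i.val + j.val + 1 = 2 then (1 : L) else 0) w.1))
    (h2deep : ∀ i j : Fin 2, Valued.v (((Γ : Matrix (Fin 2) (Fin 2) (w.1.adicCompletion L)) - 1) i j) ≤ Valued.v ((ϖ : (w.1.adicCompletion L)) ^ 2))
    {N : ℕ} (hN1 : 1 ≤ N) (hN : Valued.v ((Γ : Matrix (Fin 2) (Fin 2) (w.1.adicCompletion L)).trace ^ 2 - 4 * (Γ : Matrix (Fin 2) (Fin 2) (w.1.adicCompletion L)).det) = WithZero.exp (-((2 * N : ℕ) : ℤ)))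
    (hY : (u⁻¹ * Γ * u : GL (Fin 2) (w.1.adicCompletion L)) ∈ glInt 2 (w.1.adicCompletion L)) :
    ∀ a b : Fin 2, Valued.v ((((u⁻¹ * Γ * u : GL (Fin 2) (w.1.adicCompletion L)) : Matrix (Fin 2) (Fin 2) (w.1.adicCompletion L)) - 1) a b) ≤ Valued.v (ϖ : (w.1.adicCompletion L)) := by
  have hϖ1 : Valued.v (ϖ : (w.1.adicCompletion L)) ≤ 1 := by rw [hϖ, ← WithZero.exp_zero]; exact WithZero.exp_le_exp.2 (by norm_num)
  have h2w : Valued.v (2 : (w.1.adicCompletion L)) = 1 := (isUnit_two_integer_iff_valued_eq_one L w.1).1 h2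
  -- `|½ tr Γ − 1| ≤ |ϖ²|`
  have hc : Valued.v ((Γ : Matrix (Fin 2) (Fin 2) (w.1.adicCompletion L)).trace / 2 - 1) ≤ Valued.v ((ϖ : (w.1.adicCompletion L)) ^ 2) := by
    have e : (Γ : Matrix (Fin 2) (Fin 2) (w.1.adicCompletion L)).trace / 2 - 1 = (((Γ : Matrix (Fin 2) (Fin 2) (w.1.adicCompletion L)) - 1) 0 0 + ((Γ : Matrix (Fin 2) (Fin 2) (w.1.adicCompletion L)) - 1) 1 1) / 2 := by
      rw [Matrix.trace_fin_two]; simp only [Matrix.sub_apply, Matrix.one_apply_eq]; ring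
    rw [e, map_div₀, h2w, div_one]
    exact le_trans (Valuation.map_add _ _ _) (max_le (h2deep 0 0) (h2deep 1 1))
  have hc1 : Valued.v ((Γ : Matrix (Fin 2) (Fin 2) (w.1.adicCompletion L)).trace / 2) ≤ 1 := by
    have e : (Γ : Matrix (Fin 2) (Fin 2) (w.1.adicCompletion L)).trace / 2 = ((Γ : Matrix (Fin 2) (Fin 2) (w.1.adicCompletion L)).trace / 2 - 1) + 1 := by ring
    rw [e]
    refine le_trans (Valuation.map_add _ _ _) (max_le (le_trans hc ?_) (by rw [map_one]))
    rw [map_pow]; exact pow_le_one₀ zero_le hϖ1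
  -- the entries of `E = Y − c·1` are integral (`Y ∈ GL₂(𝒪_w)`), i.e. `≤ |ϖ^(2·0)|`
  have hYi := ((HermitianLatticeTree.mem_glInt_iff_forall_v_le_one_and_v_det_eq_one _).1 hY).1
  have hE : ∀ a b : Fin 2, Valued.v ((((u⁻¹ * Γ * u : GL (Fin 2) (w.1.adicCompletion L)) : Matrix (Fin 2) (Fin 2) (w.1.adicCompletion L)) - ((Γ : Matrix (Fin 2) (Fin 2) (w.1.adicCompletion L)).trace / 2) • (1 : Matrix (Fin 2) (Fin 2) (w.1.adicCompletion L))) a b) ≤ Valued.v ((ϖ : (w.1.adicCompletion L)) ^ (2 * 0)) := by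
    intro a b
    rw [mul_zero, pow_zero, map_one, Matrix.sub_apply, Matrix.smul_apply, smul_eq_mul]
    refine le_trans (Valuation.map_sub _ _ _) (max_le (hYi a b) ?_)
    rw [map_mul]
    by_cases hab : a = b
    · rw [hab, Matrix.one_apply_eq, map_one, mul_one]; exact hc1
    · rw [Matrix.one_apply_ne hab, map_zero, mul_zero]; exact zero_le
  obtain ⟨-, hcol⟩ := depth_collapse_of_twoDeep L v w hw he h2 ϖ hϖ hσϖ Γ u hΓ hu h2deep hN (j := 0) (by omega) hE
  intro a b
  have e : ((((u⁻¹ * Γ * u : GL (Fin 2) (w.1.adicCompletion L))) : Matrix (Fin 2) (Fin 2) (w.1.adicCompletion L)) - 1) a b =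
      ((((u⁻¹ * Γ * u : GL (Fin 2) (w.1.adicCompletion L))) : Matrix (Fin 2) (Fin 2) (w.1.adicCompletion L)) - ((Γ : Matrix (Fin 2) (Fin 2) (w.1.adicCompletion L)).trace / 2) • (1 : Matrix (Fin 2) (Fin 2) (w.1.adicCompletion L))) a b +
        ((Γ : Matrix (Fin 2) (Fin 2) (w.1.adicCompletion L)).trace / 2 - 1) * (1 : Matrix (Fin 2) (Fin 2) (w.1.adicCompletion L)) a b := by
    simp only [Matrix.sub_apply, Matrix.smul_apply, smul_eq_mul]; ring
  rw [e]
  refine le_trans (Valuation.map_add _ _ _) (max_le ?_ ?_)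
  · have h := hcol a b
    rwa [mul_zero, zero_add, pow_one] at h
  · rw [map_mul]
    by_cases hab : a = b
    · rw [hab, Matrix.one_apply_eq, map_one, mul_one]
      refine le_trans hc ?_
      rw [map_pow, sq]; exact mul_le_of_le_one_left zero_le hϖ1
    · rw [Matrix.one_apply_ne hab, map_zero, mul_zero]; exact zero_le

set_option maxHeartbeats 800000 in
include hw in
/-- **`LEV₂(ϖ³)` IS AUTOMATIC for `N ≥ 2`** (the W-side `reg` family is empty): under the hypotheses of `forall_v_conj_sub_one_le_of_twoDeep` with `N ≥ 2`,
`|((Y − 1)²)_{ab}|_w ≤ |ϖ³|` — `(Y − 1)² = E² + 2(c − 1)E + (c − 1)²·1` with `E² = ¼disc·1` (`|disc| = exp(−2N) ≤ |ϖ⁴|`), `|c − 1| ≤ |ϖ²|`, `|E_{ab}| ≤ |ϖ|`.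
[cite: LabesseLanglands1979, §2 Lemma 2.1 p. 8] [cite: Rogawski1990, §4.9 p. 55] -/
theorem forall_v_conj_sub_one_sq_le_of_twoDeep (he : v.asIdeal.ramificationIdx' w.1.asIdeal ≠ 1) (h2 : IsUnit (2 : 𝒪[(w.1.adicCompletion L)]))
    (ϖ : (w.1.adicCompletion L)ˣ) (hϖ : Valued.v (ϖ : (w.1.adicCompletion L)) = WithZero.exp (-1 : ℤ))
    (hσϖ : galAdicCompletionMap (L := L) (IsCMField.complexConj L) hw (ϖ : (w.1.adicCompletion L)) = -(ϖ : (w.1.adicCompletion L)))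
    (Γ u : GL (Fin 2) (w.1.adicCompletion L))
    (hΓ : Γ ∈ unitaryGroupOfForm (galAdicCompletionMap (L := L) (IsCMField.complexConj L) hw) (placeForm (Matrix.of fun i j : Fin 2 => if i.val + j.val + 1 = 2 then (1 : L) else 0) w.1))
    (hu : u ∈ unitaryGroupOfForm (galAdicCompletionMap (L := L) (IsCMField.complexConj L) hw) (placeForm (Matrix.of fun i j : Fin 2 => if i.val + j.val + 1 = 2 then (1 : L) else 0) w.1))
    (h2deep : ∀ i j : Fin 2, Valued.v (((Γ : Matrix (Fin 2) (Fin 2) (w.1.adicCompletion L)) - 1) i j) ≤ Valued.v ((ϖ : (w.1.adicCompletion L)) ^ 2))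
    {N : ℕ} (hN2 : 2 ≤ N) (hN : Valued.v ((Γ : Matrix (Fin 2) (Fin 2) (w.1.adicCompletion L)).trace ^ 2 - 4 * (Γ : Matrix (Fin 2) (Fin 2) (w.1.adicCompletion L)).det) = WithZero.exp (-((2 * N : ℕ) : ℤ)))
    (hY : (u⁻¹ * Γ * u : GL (Fin 2) (w.1.adicCompletion L)) ∈ glInt 2 (w.1.adicCompletion L)) :
    ∀ a b : Fin 2, Valued.v ((((((u⁻¹ * Γ * u : GL (Fin 2) (w.1.adicCompletion L))) : Matrix (Fin 2) (Fin 2) (w.1.adicCompletion L)) - 1) * ((((u⁻¹ * Γ * u : GL (Fin 2) (w.1.adicCompletion L))) : Matrix (Fin 2) (Fin 2) (w.1.adicCompletion L)) - 1)) a b) ≤ Valued.v ((ϖ : (w.1.adicCompletion L)) ^ 3) := by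
  have hϖ0 : (ϖ : (w.1.adicCompletion L)) ≠ 0 := ϖ.ne_zero
  have hϖ1 : Valued.v (ϖ : (w.1.adicCompletion L)) ≤ 1 := by rw [hϖ, ← WithZero.exp_zero]; exact WithZero.exp_le_exp.2 (by norm_num)
  have h2w : Valued.v (2 : (w.1.adicCompletion L)) = 1 := (isUnit_two_integer_iff_valued_eq_one L w.1).1 h2
  have h2w0 : (2 : (w.1.adicCompletion L)) ≠ 0 := fun h0 => by rw [h0, map_zero] at h2w; exact zero_ne_one h2w
  have hϖpow : ∀ k : ℕ, Valued.v ((ϖ : (w.1.adicCompletion L)) ^ k) = WithZero.exp (-(k : ℤ)) := by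
    intro k; rw [map_pow, hϖ, ← WithZero.exp_nsmul]; simp
  have hc : Valued.v ((Γ : Matrix (Fin 2) (Fin 2) (w.1.adicCompletion L)).trace / 2 - 1) ≤ Valued.v ((ϖ : (w.1.adicCompletion L)) ^ 2) := by
    have e : (Γ : Matrix (Fin 2) (Fin 2) (w.1.adicCompletion L)).trace / 2 - 1 = (((Γ : Matrix (Fin 2) (Fin 2) (w.1.adicCompletion L)) - 1) 0 0 + ((Γ : Matrix (Fin 2) (Fin 2) (w.1.adicCompletion L)) - 1) 1 1) / 2 := by
      rw [Matrix.trace_fin_two]; simp only [Matrix.sub_apply, Matrix.one_apply_eq]; ring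
    rw [e, map_div₀, h2w, div_one]
    exact le_trans (Valuation.map_add _ _ _) (max_le (h2deep 0 0) (h2deep 1 1))
  have hE1 := forall_v_conj_sub_one_le_of_twoDeep L v w hw he h2 ϖ hϖ hσϖ Γ u hΓ hu h2deep (by omega) hN hY
  -- `E := Y − c1 = (Y − 1) − (c − 1)·1` has entries `≤ |ϖ|`
  set Y : Matrix (Fin 2) (Fin 2) (w.1.adicCompletion L) := ((u⁻¹ * Γ * u : GL (Fin 2) (w.1.adicCompletion L)) : Matrix (Fin 2) (Fin 2) (w.1.adicCompletion L)) with hYdef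
  set c : (w.1.adicCompletion L) := (Γ : Matrix (Fin 2) (Fin 2) (w.1.adicCompletion L)).trace / 2 with hcdef
  have hEab : ∀ a b : Fin 2, Valued.v ((Y - c • (1 : Matrix (Fin 2) (Fin 2) (w.1.adicCompletion L))) a b) ≤ Valued.v (ϖ : (w.1.adicCompletion L)) := by
    intro a b
    have e : (Y - c • (1 : Matrix (Fin 2) (Fin 2) (w.1.adicCompletion L))) a b = (Y - 1) a b - (c - 1) * (1 : Matrix (Fin 2) (Fin 2) (w.1.adicCompletion L)) a b := by
      simp only [Matrix.sub_apply, Matrix.smul_apply, smul_eq_mul]; ring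
    rw [e]
    refine le_trans (Valuation.map_sub _ _ _) (max_le (hE1 a b) ?_)
    rw [map_mul]
    by_cases hab : a = b
    · rw [hab, Matrix.one_apply_eq, map_one, mul_one]; refine le_trans hc ?_; rw [map_pow, sq]; exact mul_le_of_le_one_left zero_le hϖ1
    · rw [Matrix.one_apply_ne hab, map_zero, mul_zero]; exact zero_le
  -- `(Y − 1)² = E² + (2(c−1))•E + (c−1)²•1`, `E² = ((c² − det) • 1`
  have htrc : Y.trace = (Γ : Matrix (Fin 2) (Fin 2) (w.1.adicCompletion L)).trace := by
    rw [hYdef, Units.val_mul, Units.val_mul]; exact Matrix.trace_units_conj' u _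
  have hdetc : Y.det = (Γ : Matrix (Fin 2) (Fin 2) (w.1.adicCompletion L)).det := by
    rw [hYdef, Units.val_mul, Units.val_mul]; exact Matrix.det_units_conj' u _
  have hCH := sq_sub_half_trace_smul_one h2w0 Y
  rw [htrc, hdetc, ← hcdef] at hCH
  have hexp : (Y - 1) * (Y - 1) = (Y - c • (1 : Matrix (Fin 2) (Fin 2) (w.1.adicCompletion L))) * (Y - c • (1 : Matrix (Fin 2) (Fin 2) (w.1.adicCompletion L))) +
      (2 * (c - 1)) • (Y - c • (1 : Matrix (Fin 2) (Fin 2) (w.1.adicCompletion L))) + ((c - 1) ^ 2) • (1 : Matrix (Fin 2) (Fin 2) (w.1.adicCompletion L)) := by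
    have e1 : Y - 1 = (Y - c • (1 : Matrix (Fin 2) (Fin 2) (w.1.adicCompletion L))) + (c - 1) • (1 : Matrix (Fin 2) (Fin 2) (w.1.adicCompletion L)) := by
      rw [sub_smul, one_smul]; abel
    rw [e1, Matrix.add_mul, Matrix.mul_add, Matrix.mul_add, Matrix.smul_mul, Matrix.mul_smul, Matrix.mul_one, Matrix.one_mul, Matrix.smul_mul, Matrix.one_mul, smul_smul]
    rw [show (c - 1) * (c - 1) = (c - 1) ^ 2 by ring, show (2 * (c - 1)) • (Y - c • (1 : Matrix (Fin 2) (Fin 2) (w.1.adicCompletion L))) =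
      (c - 1) • (Y - c • (1 : Matrix (Fin 2) (Fin 2) (w.1.adicCompletion L))) + (c - 1) • (Y - c • (1 : Matrix (Fin 2) (Fin 2) (w.1.adicCompletion L))) by rw [← add_smul]; ring_nf]
    abel
  rw [hCH] at hexp
  -- the three valuations
  have hdisc : Valued.v (c ^ 2 - (Γ : Matrix (Fin 2) (Fin 2) (w.1.adicCompletion L)).det) ≤ Valued.v ((ϖ : (w.1.adicCompletion L)) ^ 3) := by
    have e : c ^ 2 - (Γ : Matrix (Fin 2) (Fin 2) (w.1.adicCompletion L)).det = ((Γ : Matrix (Fin 2) (Fin 2) (w.1.adicCompletion L)).trace ^ 2 - 4 * (Γ : Matrix (Fin 2) (Fin 2) (w.1.adicCompletion L)).det) / 4 := by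
      rw [hcdef]; field_simp; ring
    have hv4 : Valued.v (4 : (w.1.adicCompletion L)) = 1 := by rw [show (4 : (w.1.adicCompletion L)) = 2 * 2 by norm_num, map_mul, h2w, one_mul]
    rw [e, map_div₀, hv4, div_one, hN, hϖpow, WithZero.exp_le_exp]; push_cast; omega
  have hc1 : Valued.v (c - 1) ≤ Valued.v ((ϖ : (w.1.adicCompletion L)) ^ 2) := hc
  intro a b
  rw [hexp]
  simp only [Matrix.add_apply, Matrix.smul_apply, smul_eq_mul]
  refine le_trans (Valuation.map_add _ _ _) (max_le (le_trans (Valuation.map_add _ _ _) (max_le ?_ ?_)) ?_)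
  · rw [map_mul]
    by_cases hab : a = b
    · rw [hab, Matrix.one_apply_eq, map_one, mul_one]; exact hdisc
    · rw [Matrix.one_apply_ne hab, map_zero, mul_zero]; exact zero_le
  · rw [map_mul, map_mul, h2w, one_mul, pow_succ, map_mul]
    exact mul_le_mul' hc1 (hEab a b)
  · rw [map_mul, map_pow]
    by_cases hab : a = b
    · rw [hab, Matrix.one_apply_eq, map_one, mul_one]
      calc Valued.v (c - 1) ^ 2 ≤ Valued.v ((ϖ : (w.1.adicCompletion L)) ^ 2) ^ 2 := pow_le_pow_left₀ zero_le hc1 2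
        _ ≤ Valued.v ((ϖ : (w.1.adicCompletion L)) ^ 3) := by rw [hϖpow, hϖpow, ← WithZero.exp_nsmul, WithZero.exp_le_exp]; simp only [nsmul_eq_mul]; omega
    · rw [Matrix.one_apply_ne hab, map_zero, mul_zero]; exact zero_le
end Structure

end Literature.NumberTheory.Automorphic.UnitaryGroup

end
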